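import Summits.QuantumFields.YangMills.Theorems.BalabanUVNodesN08AlphaHistGeom
import HarnessLib

/-!
# `AlphaInputsT3ACv3ProfileThetaE` — STRATEGY B for 2′, (D6L)-CORE FORK, PART F4′: THE SCALE CUT-OFFS OVER THE **ENLARGED** REGIONS
# `Ω′_j(h) = {x | ∃ y ∈ Ω_j(h), |x − y|₁ ≤ 39·L^j + 2}`, `1 ≤ j ≤ k` (a scale-`k` layer included), and the KEY NESTING FACT `supp θ′_{j+1} ⊆ Ω_j ⊆ {θ′_j = 1}` under the
# collar row (N2′) `39·L + R + 8 ≤ Rcol j` — lane `pub-balaban3d`, seat alpha-2 (g2)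

WHY (HOME `D6-AUDIT-alpha2-g2.md` §7).  The displayed row `AlphaInputsT3AC.RegularProfileNearT3` (`AlphaInputsT3ACv3CoreNonempty`) asks for a regular, (67)-large profile whose
fine plaquettes within `ℓ¹`-distance `39·L^{i₀}` of every read region are `α₀·L^{−2i₀}`-small.  NODE O's profile (`…ProfileBuild.prof`, cut-offs `…HistGeom.Theta` = `1` only within
distance `2` of `Ω_j(h)`, no scale-`k` layer) carries the coarser pattern there; the fork replaces `Ω_j(h)` by its `(39·L^j + 2)`-neighbourhood `OmegaE` in the cut-offs and adds the
level `j = k`.  THIS FILE is the twin of `…HistGeom` §5 for the enlarged regions: `enlRad`, `OmegaE`, `ThetaE`; `ThetaE_eq_one_of_distTo_le` (`θ′_j = 1` within `39·L^j + 2` of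
`Ω_j(h)`); ★ `ThetaE_succ_eq_zero_of_bad` (the collar (N2′) keeps `θ′_{j+1}` away from the covers of `P_j(h)` and from `Ω_j(h)ᶜ`); ★ `mem_Omega_of_ThetaE_succ_ne_zero` (KEY NESTING
FACT), `ThetaE_succ_le`, `ThetaE_antitone`, `abs_ThetaE_sub_le`.  The twins F5b′–F5e′ (blend, regularity, largeness, near-reads smallness) are the successor's (memo §7).
HONEST FRAMING.  Torus bookkeeping over the lane's regions `Carriers.Omega`; nothing of [B10] asserted; count-neutral helper toward R3 2′ (`stub_laneRecordsV3`, items 19935∕19936);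
nothing about d = 4, the continuum, or a mass gap.

References: T. Bałaban, Commun. Math. Phys. 102 (1985) 255–275 [Balaban1985UV3] ((38)–(39) p.266, (67)–(68) p.273).
-/

set_option autoImplicit false

noncomputable section

namespace Summit.QuantumFields.YangMills.Theorems.ProfileEnlarged

open Literature.MathematicalPhysics.QuantumFieldTheory.Balaban1983to89
open Literature.MathematicalPhysics.QuantumFieldTheory.Balaban1985CMP102.Setting
open Summit.QuantumFields.Balaban3D.Carriers
open Summit.QuantumFields.YangMills.Theorems.BalabanUVNodesN08AlphaHistGeom
open B3Taylor310LocalRemainder (tdist_comm tdist_triangle)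

variable {L : ℕ} {S : Scales L}

/-! ## §1 The enlarged regions -/

/-- **THE ENLARGEMENT RADIUS** `D_j = 39·L^j + 2` (the radius of the (D6L)-core interface `localSmallT3_of_plaqSmall_near_reads`, plus `2` for plaquette corners). [folklore] -/
def enlRad (S : Scales L) (j : ℕ) : ℕ := 39 * S.P.L ^ j + 2

variable (M₁ : ℕ) (Rcol : ℕ → ℕ)

/-- **THE ENLARGED REGION `Ω′_j(h)`**: the fine sites within `ℓ¹` torus distance `D_j` of SOME site of `Ω_j(h)` (empty if `Ω_j(h)` is). [cite: Balaban1985UV3, (38) p.266] -/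
def OmegaE (k : ℕ) (h : Hist S.P k) (j : ℕ) : Set (Site S.P 0) :=
  {x | ∃ y ∈ Omega M₁ Rcol k h j, Site.tdist x y ≤ enlRad S j}

variable {M₁ Rcol}

/-- `Ω_j(h) ⊆ Ω′_j(h)`. [folklore] -/
theorem Omega_subset_OmegaE {k : ℕ} (h : Hist S.P k) (j : ℕ) : Omega M₁ Rcol k h j ⊆ OmegaE M₁ Rcol k h j :=
  fun x hx => ⟨x, hx, by rw [tdist_self']; exact Nat.zero_le _⟩

/-- A site within `D_j` of `Ω_j(h)` (non-empty) lies in `Ω′_j(h)`. [folklore] -/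
theorem mem_OmegaE_of_distTo_le {k : ℕ} {h : Hist S.P k} {j : ℕ} (hne : (Omega M₁ Rcol k h j).Nonempty) {x : Site S.P 0}
    (hx : distTo (Omega M₁ Rcol k h j) x ≤ enlRad S j) : x ∈ OmegaE M₁ Rcol k h j := by
  obtain ⟨y, hy, hd⟩ := exists_tdist_eq_distTo hne x
  exact ⟨y, hy, by rw [hd]; exact hx⟩

/-- A site of `Ω′_j(h)` is within `D_j` of `Ω_j(h)`. [folklore] -/
theorem distTo_le_of_mem_OmegaE {k : ℕ} {h : Hist S.P k} {j : ℕ} {x : Site S.P 0} (hx : x ∈ OmegaE M₁ Rcol k h j) :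
    distTo (Omega M₁ Rcol k h j) x ≤ enlRad S j := by
  obtain ⟨y, hy, hd⟩ := hx
  exact (distTo_le hy).trans hd

/-! ## §2 The cut-offs over the enlarged regions (a scale-`k` layer included) -/

variable (M₁ Rcol) (R : ℕ) {k : ℕ} (h : Hist S.P k)

/-- **THE SCALE CUT-OFFS `θ′_j` OVER THE ENLARGED REGIONS** (`1 ≤ j ≤ k`; width `W_j = R·L^{j−1}`; `θ′_0 ≡ 1`, `θ′_j ≡ 0` for `j > k`). [folklore] -/
def ThetaE (j : ℕ) (x : Site S.P 0) : ℝ :=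
  if k < j then 0 else if j = 0 then 1 else theta (OmegaE M₁ Rcol k h j) (R * S.P.L ^ (j - 1)) x

/-- `0 ≤ θ′ ≤ 1`. [folklore] -/
theorem ThetaE_mem (j : ℕ) (x : Site S.P 0) : 0 ≤ ThetaE M₁ Rcol R h j x ∧ ThetaE M₁ Rcol R h j x ≤ 1 := by
  unfold ThetaE; split_ifs
  · exact ⟨le_rfl, zero_le_one⟩
  · exact ⟨zero_le_one, le_rfl⟩
  · exact theta_mem _ _ _

/-- `θ′_0 = 1`. [folklore] -/
theorem ThetaE_zero (x : Site S.P 0) : ThetaE M₁ Rcol R h 0 x = 1 := by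
  unfold ThetaE; rw [if_neg (by omega), if_pos rfl]

/-- `θ′_j = 0` for `j > k`. [folklore] -/
theorem ThetaE_of_lt {j : ℕ} (hj : k < j) (x : Site S.P 0) : ThetaE M₁ Rcol R h j x = 0 := by
  unfold ThetaE; rw [if_pos hj]

/-- **`θ′_j = 1` WITHIN `ℓ¹`-DISTANCE `39·L^j + 2` OF `Ω_j(h)`** (`j ≤ k`, `R ≥ 1`, `Ω_j(h) ≠ ∅` or `j = 0`) — in particular on `Ω_j(h)` and on the whole radius of the (D6L)-core interface.
[folklore] -/
theorem ThetaE_eq_one_of_distTo_le (hR : 1 ≤ R) {j : ℕ} (hjk : j ≤ k) {x : Site S.P 0} (hne : j = 0 ∨ (Omega M₁ Rcol k h j).Nonempty)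
    (hx : distTo (Omega M₁ Rcol k h j) x ≤ enlRad S j) : ThetaE M₁ Rcol R h j x = 1 := by
  unfold ThetaE
  rw [if_neg (by omega)]
  split_ifs with hj0
  · rfl
  · have hne' : (Omega M₁ Rcol k h j).Nonempty := hne.resolve_left hj0
    have hxE : x ∈ OmegaE M₁ Rcol k h j := mem_OmegaE_of_distTo_le hne' hx
    exact theta_eq_one ⟨x, hxE⟩ (Nat.mul_pos hR (pow_pos S.P.L_pos _)) (by rw [distTo_eq_zero_of_mem hxE]; omega)

/-- `θ′_j = 1` on `Ω_j(h)` (`j ≤ k`). [folklore] -/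
theorem ThetaE_eq_one_of_mem (hR : 1 ≤ R) {j : ℕ} (hjk : j ≤ k) {x : Site S.P 0} (hx : x ∈ Omega M₁ Rcol k h j) : ThetaE M₁ Rcol R h j x = 1 :=
  ThetaE_eq_one_of_distTo_le M₁ Rcol R h hR hjk (Or.inr ⟨x, hx⟩) (by rw [distTo_eq_zero_of_mem hx]; exact Nat.zero_le _)

/-! ## §3 The collar (N2′) keeps `θ′_{j+1}` away from the bad sites of scale `j`; the key nesting fact -/

/-- **★ THE COLLAR (N2′) KEEPS `θ′_{j+1}` AWAY FROM THE BAD SITES OF SCALE `j`**: if `39·L + R + 8 ≤ Rcol j`, `j + 1 ≤ k ≤ m + K`, `d = 3`, `R ≥ 1`, then for every `x` covered by a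
plaquette of `P_j(h)` or outside `Ω_j(h)` and every `x′` at fine distance `≤ 2` from `x`: `θ′_{j+1}(x′) = 0` (the enlarged region `Ω′_{j+1}` is still `(Rcol_j − 2)L^j − D_{j+1} ≥
R·L^j + 4` away). [cite: Balaban1985UV3, (39) p.266] -/
theorem ThetaE_succ_eq_zero_of_bad (hd : S.P.d = 3) (hk : k ≤ S.P.m + S.P.K) {j : ℕ} (hjk : j + 1 ≤ k) (hR : 1 ≤ R) (hRcol : 39 * S.P.L + R + 8 ≤ Rcol j)
    {x : Site S.P 0} (hx : (∃ p ∈ h ⟨j, hjk⟩, x ∈ plaqCover p) ∨ x ∉ Omega M₁ Rcol k h j) {x' : Site S.P 0} (hxx' : Site.tdist x x' ≤ 2) :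
    ThetaE M₁ Rcol R h (j + 1) x' = 0 := by
  unfold ThetaE
  rw [if_neg (by omega), if_neg (Nat.succ_ne_zero j), Nat.add_sub_cancel]
  by_cases hne : (OmegaE M₁ Rcol k h (j + 1)).Nonempty
  · refine theta_eq_zero_of_le (Nat.mul_pos hR (pow_pos S.P.L_pos _)) ?_
    have hLj : 1 ≤ S.P.L ^ j := Nat.one_le_pow _ _ S.P.L_pos
    -- distance from `x` to the ENLARGED region: at least `(Rcol j − 2)·L^j − D_{j+1} ≥ R·L^j + 4`
    have hfar : R * S.P.L ^ j + 4 ≤ distTo (OmegaE M₁ Rcol k h (j + 1)) x := by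
      refine le_distTo hne fun y hy => ?_
      obtain ⟨y₀, hy₀, hyy₀⟩ := hy
      have h1 := tdist_ge_of_mem_Omega_succ M₁ Rcol hk h hjk hy₀ hx
      rw [hd] at h1
      have h2 := tdist_triangle x y y₀
      have h3 : enlRad S (j + 1) = 39 * S.P.L * S.P.L ^ j + 2 := by unfold enlRad; rw [pow_succ]; ring
      rw [h3] at hyy₀
      have h4 : (39 * S.P.L + R + 8 + 1 - 3) * S.P.L ^ j ≤ (Rcol j + 1 - 3) * S.P.L ^ j := Nat.mul_le_mul_right _ (by omega)
      have h5 : (39 * S.P.L + R + 8 + 1 - 3) * S.P.L ^ j = 39 * S.P.L * S.P.L ^ j + R * S.P.L ^ j + 6 * S.P.L ^ j := by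
        rw [show 39 * S.P.L + R + 8 + 1 - 3 = 39 * S.P.L + R + 6 by omega]; ring
      rw [h5] at h4
      omega
    have hlip := distTo_le_distTo_add hne x' x
    rw [tdist_comm x' x] at hlip
    omega
  · exact theta_eq_zero_of_not_nonempty hne _ _

/-- **★ KEY NESTING FACT**: under (N2′), `θ′_{j+1}(x) ≠ 0 ⇒ x ∈ Ω_j(h)` (`j + 1 ≤ k`) — the support of the scale-`(j+1)` cut-off lies inside the ORIGINAL `Ω_j(h)`, where `θ′_j = 1`.
[cite: Balaban1985UV3, (39) p.266] -/
theorem mem_Omega_of_ThetaE_succ_ne_zero (hd : S.P.d = 3) (hk : k ≤ S.P.m + S.P.K) {j : ℕ} (hjk : j + 1 ≤ k) (hR : 1 ≤ R) (hRcol : 39 * S.P.L + R + 8 ≤ Rcol j)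
    {x : Site S.P 0} (hne : ThetaE M₁ Rcol R h (j + 1) x ≠ 0) : x ∈ Omega M₁ Rcol k h j := by
  by_contra hxΩ
  exact hne (ThetaE_succ_eq_zero_of_bad M₁ Rcol R h hd hk hjk hR hRcol (Or.inr hxΩ) (by rw [tdist_self']; omega))

/-- **MONOTONICITY IN THE SCALE: `θ′_{j+1} ≤ θ′_j`** (collars (N2′) for `j + 1 ≤ k`). [folklore] -/
theorem ThetaE_succ_le (hd : S.P.d = 3) (hk : k ≤ S.P.m + S.P.K) (hR : 1 ≤ R) (hRcol : ∀ j, j + 1 ≤ k → 39 * S.P.L + R + 8 ≤ Rcol j) (j : ℕ) (x : Site S.P 0) :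
    ThetaE M₁ Rcol R h (j + 1) x ≤ ThetaE M₁ Rcol R h j x := by
  by_cases hjk : j + 1 ≤ k
  · by_cases hz : ThetaE M₁ Rcol R h (j + 1) x = 0
    · rw [hz]; exact (ThetaE_mem M₁ Rcol R h j x).1
    · have hxΩ := mem_Omega_of_ThetaE_succ_ne_zero M₁ Rcol R h hd hk hjk hR (hRcol j hjk) hz
      rw [ThetaE_eq_one_of_mem M₁ Rcol R h hR (by omega) hxΩ]
      exact (ThetaE_mem M₁ Rcol R h (j + 1) x).2
  · rw [ThetaE_of_lt M₁ Rcol R h (by omega)]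
    exact (ThetaE_mem M₁ Rcol R h j x).1

/-- Antitonicity `θ′_{j′} ≤ θ′_j` for `j ≤ j′`. [folklore] -/
theorem ThetaE_antitone (hd : S.P.d = 3) (hk : k ≤ S.P.m + S.P.K) (hR : 1 ≤ R) (hRcol : ∀ j, j + 1 ≤ k → 39 * S.P.L + R + 8 ≤ Rcol j) {j j' : ℕ} (hjj' : j ≤ j')
    (x : Site S.P 0) : ThetaE M₁ Rcol R h j' x ≤ ThetaE M₁ Rcol R h j x := by
  induction hjj' with
  | refl => exact le_rfl
  | step _ ih => exact (ThetaE_succ_le M₁ Rcol R h hd hk hR hRcol _ x).trans ih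

/-- **The enlarged cut-offs are Lipschitz**: `|θ′_j(x) − θ′_j(x′)| ≤ tdist x x′ / (R·L^{j−1})` for `1 ≤ j` (and `0` for `j = 0` or `j > k`). [folklore] -/
theorem abs_ThetaE_sub_le (hR : 1 ≤ R) {j : ℕ} (hj : 1 ≤ j) (x x' : Site S.P 0) :
    |ThetaE M₁ Rcol R h j x - ThetaE M₁ Rcol R h j x'| ≤ (Site.tdist x x' : ℝ) / (R * S.P.L ^ (j - 1) : ℕ) := by
  unfold ThetaE
  split_ifs with h1 h2
  · rw [sub_self, abs_zero]; positivity
  · omega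
  · exact abs_theta_sub_le _ (Nat.mul_pos hR (pow_pos S.P.L_pos _)) x x'

/-- `θ′_0` is constant. [folklore] -/
theorem ThetaE_zero_sub (x x' : Site S.P 0) : ThetaE M₁ Rcol R h 0 x - ThetaE M₁ Rcol R h 0 x' = 0 := by
  rw [ThetaE_zero, ThetaE_zero, sub_self]

/-- **THE INTERFACE RADIUS IS INSIDE `{θ′_i = 1}`**: a fine plaquette corner within `ℓ¹`-distance `39·L^{i₀} + 2` of a subset `T ⊆ Ω_i(h)` (`i₀ ≤ i ≤ k`, `T ≠ ∅`) has `θ′_i = 1` —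
the form in which F5e′ (`plaqSmall_prof′_near_reads`) consumes the cut-offs, with `T = lam42 Ω(h) k i`. [folklore] -/
theorem ThetaE_eq_one_near_subset (hR : 1 ≤ R) {i₀ i : ℕ} (hi₀ : i₀ ≤ i) (hik : i ≤ k) {T : Set (Site S.P 0)} (hT : T ⊆ Omega M₁ Rcol k h i) (hTne : T.Nonempty)
    {x : Site S.P 0} (hx : distTo T x ≤ 39 * S.P.L ^ i₀ + 2) : ThetaE M₁ Rcol R h i x = 1 := by
  obtain ⟨y, hy, hyd⟩ := exists_tdist_eq_distTo hTne x
  have hne : (Omega M₁ Rcol k h i).Nonempty := ⟨y, hT hy⟩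
  refine ThetaE_eq_one_of_distTo_le M₁ Rcol R h hR hik (Or.inr hne) ((distTo_le (hT hy)).trans ?_)
  rw [hyd]
  refine hx.trans ?_
  unfold enlRad
  have : S.P.L ^ i₀ ≤ S.P.L ^ i := Nat.pow_le_pow_right S.P.L_pos hi₀
  omega

end Summit.QuantumFields.YangMills.Theorems.ProfileEnlarged

end
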